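import Literature.MathematicalPhysics.QuantumFieldTheory.Balaban1983to89.T3AlphaInputsACSchemas
import HarnessLib

/-!
# `Balaban1983to89.T3AlphaInputsACHistorySplit` — PROVED READINGS of the opened history functional `LFSum` of the (α) socket
# (`T3AlphaInputsACSchemas` §2): (41)'s sum over region histories SPLIT into the trivial history's term («all Ω_j = T_η», the term that (47) keeps)
# and the large-field remainder; the trivial term's closed form; its domination by the whole functional (the structural half of (47) vs (41));
# and the vanishing of the trivial term at a datum with a large plaquette (theorems only; successor module, no edit of the socket files)

statement-level skeleton of published theorems with citation tags; proofs where landed; nothing here is a claim about the Yang–Mills mass gap.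

v1.1 (doc-only erratum, same sitting, before any importer): two guillemet quotations of v1 corrected to the printed wording (p.272 sentence; (40)).

Typer lineage (gen 41), page support for crux 18916's S5 («numerator decoupling» over the histories of (41)) and for any consumer of
`T3AlphaInputsACSchemas.AlphaInputsT3ACFull`.  Everything is a THEOREM over the hypothesis schemas `LFSum` / `NoTrivOnLarge` with the schemas as
explicit hypotheses; nothing is asserted about Bałaban's data and no definition is introduced.  Print: [Balaban1985UV3] (41) p.266 is a SUM over
the sequences of domains `{Ω_j}` of conditional large-field integrals; the trivial sequence (all `Ω_j = T_η`, all `Z_j = ∅`) carries no large-field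
integration and no `Z`-terms — p.272 «The lower bound is proved in the same way, with all simplifications coming from the fact that Ω_{k+1} =
T_η.» — and (47) p.267 is the lower bound by exactly such a term («where the characteristic function χ_k corresponds to the
restrictions on V given by the conditions |U_k(∂p) − 1| < g_kp(g_k)η², p ⊂ T_η»).

* §1 `trivTerm_eq` (under `LFSum`: the trivial region history's fibre integral is `(∫ wt(triv, v, W) dv)·exp Φ(triv)`, since `assemble triv v = triv`),
  `lf_eq_trivTerm_add_sum_erase` ((41) = trivial term + Σ over the non-trivial region histories), `trivTerm_le_lf` (the trivial term is dominated
  by the whole functional: every other term is an integral of a non-negative function), `exp_le_lf_of_wt_triv` (if the trivial weight integrates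
  to at least `1`, `exp Φ(triv) ≤ LF(W)[Φ]`).
* §3 (consumer ask ★ym-ust-18916-p1 g2 20:09Z, R0 clause stated inline): `trivTerm_eq_of_wt_eq` (weight constant in the fibre ⇒ term = c·exp Φ(triv)),
  `upTrivTerm_eq_low_mul` (trivial weight `= χ_j(W)` ⇒ the trivial term of `up` is `low·e^{Zterm(triv)}`), `up_eq_low_mul_add_sum_erase`, `low_mul_exp_le_up`,
  `low_le_up` / `upTrivTerm_eq_low` (with `Zterm(triv) = 0`).
* §2 `lf_eq_sum_erase_of_large` (under `LFSum` and `NoTrivOnLarge`: at a datum with a `2L²B₃θ`-large plaquette the trivial term vanishes and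
  `LF(W)[Φ]` is the sum over the NON-trivial region histories only — the entry point of the per-plaquette tail estimate), and its `up`-form
  `up_eq_sum_erase_of_large` for the (41)-majorant `up_j(W) = LF_j(W)[exp(−mainT + Pint + Zterm)]`.

References: T. Bałaban, CMP 102 (1985) 255–275 [Balaban1985UV3] ((38)–(41) p.266, (47) p.267, p.272).
-/

noncomputable section

open MeasureTheory
open Literature.MathematicalPhysics.QuantumFieldTheory.Balaban1983to89.T3ContinuumYM3Torus
open Literature.MathematicalPhysics.QuantumFieldTheory.Balaban1983to89.T3UnitScaleTilt
open Literature.MathematicalPhysics.QuantumFieldTheory.Balaban1983to89.T3AlphaInputsAC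
open Literature.MathematicalPhysics.QuantumFieldTheory.Balaban1983to89.T3AlphaInputsACSchemas

namespace Literature.MathematicalPhysics.QuantumFieldTheory.Balaban1983to89.T3AlphaInputsACHistorySplit

variable {F : T3Family} {γ : ℝ} {D : AlphaDataT3 F γ} {W : LFData D}

/-! ## §1 The trivial history's term of (41) -/

/-- **THE TRIVIAL REGION HISTORY'S TERM IN CLOSED FORM**: under `LFSum`, `assemble triv v = triv` for every fibre value, so the trivial term of (41) is
`(∫ wt(triv, v, W) dv)·exp Φ(triv)` — no large-field variable enters the exponent (p.272 «all simplifications coming from the fact that Ω_{k+1} = T_η»).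
[cite: Balaban1985UV3, (41) p.266 and p.272] -/
theorem trivTerm_eq (h : LFSum D W) (K j : ℕ) (Wf : GaugeField (F.P K) j (Matrix.specialUnitaryGroup (Fin 2) ℂ)) (Φ : D.Hist K j → ℝ) :
    ∫ v, W.wt K j (W.trivReg K j) v Wf * Real.exp (Φ (W.assemble K j (W.trivReg K j) v))
        ∂Measure.pi (fun i : Fin j => fieldMeasure (F.P K) (i : ℕ) (Matrix.specialUnitaryGroup (Fin 2) ℂ)) =
      (∫ v, W.wt K j (W.trivReg K j) v Wf
          ∂Measure.pi (fun i : Fin j => fieldMeasure (F.P K) (i : ℕ) (Matrix.specialUnitaryGroup (Fin 2) ℂ))) *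
        Real.exp (Φ (D.triv K j)) := by
  rw [← integral_mul_const]
  refine integral_congr_ae (ae_of_all _ fun v => ?_)
  simp only [h.2.1 K j v]

open scoped Classical in
/-- **(41) SPLIT: THE TRIVIAL TERM PLUS THE LARGE-FIELD REMAINDER**: under `LFSum`, `LF_j(W)[Φ] = (∫ wt(triv, v, W) dv)·exp Φ(triv) +
Σ_{r ≠ triv} ∫ wt(r, v, W)·exp Φ(assemble r v) dv` — the sum over the sequences of domains `{Ω_j}` of (41) with the all-`T_η` sequence separated.
[cite: Balaban1985UV3, (41) p.266 and p.272] -/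
theorem lf_eq_trivTerm_add_sum_erase (h : LFSum D W) (K j : ℕ) (Wf : GaugeField (F.P K) j (Matrix.specialUnitaryGroup (Fin 2) ℂ))
    (Φ : D.Hist K j → ℝ) :
    D.LF K j Wf Φ =
      (∫ v, W.wt K j (W.trivReg K j) v Wf
          ∂Measure.pi (fun i : Fin j => fieldMeasure (F.P K) (i : ℕ) (Matrix.specialUnitaryGroup (Fin 2) ℂ))) *
        Real.exp (Φ (D.triv K j)) +
      (letI := W.regFintype K j
       ∑ r ∈ (Finset.univ : Finset (W.Reg K j)).erase (W.trivReg K j),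
          ∫ v, W.wt K j r v Wf * Real.exp (Φ (W.assemble K j r v))
            ∂Measure.pi (fun i : Fin j => fieldMeasure (F.P K) (i : ℕ) (Matrix.specialUnitaryGroup (Fin 2) ℂ))) := by
  letI := W.regFintype K j
  rw [h.2.2 K j Wf Φ, ← trivTerm_eq h K j Wf Φ]
  exact (Finset.add_sum_erase _ _ (Finset.mem_univ (W.trivReg K j))).symm

/-- **THE TRIVIAL TERM IS DOMINATED BY THE WHOLE FUNCTIONAL** (the structural half of (47) against (41): all other terms of the sum are integrals of
NON-NEGATIVE functions, `wt ≥ 0`, `exp > 0`; no integrability is needed for this direction). [cite: Balaban1985UV3, (41) p.266 and (47) p.267] -/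
theorem trivTerm_le_lf (h : LFSum D W) (K j : ℕ) (Wf : GaugeField (F.P K) j (Matrix.specialUnitaryGroup (Fin 2) ℂ)) (Φ : D.Hist K j → ℝ) :
    (∫ v, W.wt K j (W.trivReg K j) v Wf
        ∂Measure.pi (fun i : Fin j => fieldMeasure (F.P K) (i : ℕ) (Matrix.specialUnitaryGroup (Fin 2) ℂ))) *
      Real.exp (Φ (D.triv K j)) ≤ D.LF K j Wf Φ := by
  letI := W.regFintype K j
  rw [lf_eq_trivTerm_add_sum_erase h K j Wf Φ]
  refine le_add_of_nonneg_right (Finset.sum_nonneg fun r _ => integral_nonneg fun v => ?_)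
  exact mul_nonneg (h.1 K j r v Wf) (Real.exp_nonneg _)

/-- If the trivial weight integrates to at least `1` at the datum `W` (the characteristic functions of the all-`T_η` sequence are `1` there and the
normalised fibre measure integrates the constant), then `exp Φ(triv) ≤ LF_j(W)[Φ]`. [cite: Balaban1985UV3, (41) p.266 and (47) p.267] -/
theorem exp_le_lf_of_wt_triv (h : LFSum D W) (K j : ℕ) (Wf : GaugeField (F.P K) j (Matrix.specialUnitaryGroup (Fin 2) ℂ)) (Φ : D.Hist K j → ℝ)
    (hw : 1 ≤ ∫ v, W.wt K j (W.trivReg K j) v Wf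
        ∂Measure.pi (fun i : Fin j => fieldMeasure (F.P K) (i : ℕ) (Matrix.specialUnitaryGroup (Fin 2) ℂ))) :
    Real.exp (Φ (D.triv K j)) ≤ D.LF K j Wf Φ := by
  refine le_trans ?_ (trivTerm_le_lf h K j Wf Φ)
  have h0 : 0 ≤ Real.exp (Φ (D.triv K j)) := Real.exp_nonneg _
  nlinarith

/-! ## §2 At a datum with a large plaquette only the non-trivial histories contribute -/

open scoped Classical in
/-- **THE ENTRY POINT OF THE PER-PLAQUETTE TAIL ESTIMATE**: under `LFSum` and `NoTrivOnLarge`, at a level-`j` datum `W` with a plaquette `p` such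
that `|W(∂p) − 1| ≥ 2L²B₃·g_{j−1}p(g_{j−1})` the trivial region history's integrand vanishes identically ((40) p.266 «χ_j = Π_{p∈Λ_j} χ({|V_j(∂p) − 1| < 2L²g_{j−1}p(g_{j−1})}), j = 1, …, k, where we have denoted V_k = V», read at
the top level `j = k` with `Λ_k = Ω_k = T_η` for the trivial history; the schema exposes the constant as `B₃`, cf. p.267 «|U_k(∂p) − 1| < 2L²B₃g_{k−1}
p(g_{k−1})η²»), so `LF_j(W)[Φ]` is the sum over the NON-trivial region
histories only. [cite: Balaban1985UV3, (40)-(41) p.266] -/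
theorem lf_eq_sum_erase_of_large (h : LFSum D W) {b₀ p₀ Cχ B₃ : ℝ} (hN : NoTrivOnLarge D W b₀ p₀ Cχ B₃) {K j : ℕ} (hj : j ≤ K)
    {Wf : GaugeField (F.P K) j (Matrix.specialUnitaryGroup (Fin 2) ℂ)} {p : Plaq (F.P K) j}
    (hp : 2 * (F.L : ℝ) ^ 2 * B₃ * θBal F.L γ b₀ p₀ (K - j + 1) ≤ GaugeGroup.dist1 (GaugeField.plaqHol Wf p)) (Φ : D.Hist K j → ℝ) :
    D.LF K j Wf Φ =
      (letI := W.regFintype K j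
       ∑ r ∈ (Finset.univ : Finset (W.Reg K j)).erase (W.trivReg K j),
          ∫ v, W.wt K j r v Wf * Real.exp (Φ (W.assemble K j r v))
            ∂Measure.pi (fun i : Fin j => fieldMeasure (F.P K) (i : ℕ) (Matrix.specialUnitaryGroup (Fin 2) ℂ))) := by
  letI := W.regFintype K j
  have htriv : ∫ v, W.wt K j (W.trivReg K j) v Wf * Real.exp (Φ (W.assemble K j (W.trivReg K j) v))
      ∂Measure.pi (fun i : Fin j => fieldMeasure (F.P K) (i : ℕ) (Matrix.specialUnitaryGroup (Fin 2) ℂ)) = 0 := by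
    refine (integral_congr_ae (ae_of_all _ fun v => ?_)).trans (integral_zero _ _)
    exact triv_integrand_eq_zero hN hj hp Φ v
  rw [h.2.2 K j Wf Φ, ← Finset.add_sum_erase _ _ (Finset.mem_univ (W.trivReg K j)), htriv, zero_add]

open scoped Classical in
/-- The same for the (41)-majorant `up_j(W) = LF_j(W)[exp(−mainT + Pint + Zterm)]` of the 18916 contract: at a datum with a `2L²B₃θ`-large plaquette,
`up_j(W)` is the sum over the non-trivial region histories of the fibre integrals of `wt·exp(−mainT + Pint + Zterm)`. [cite: Balaban1985UV3, (40)-(41) p.266] -/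
theorem up_eq_sum_erase_of_large (h : LFSum D W) {b₀ p₀ Cχ B₃ : ℝ} (hN : NoTrivOnLarge D W b₀ p₀ Cχ B₃) {K j : ℕ} (hj : j ≤ K)
    {Wf : GaugeField (F.P K) j (Matrix.specialUnitaryGroup (Fin 2) ℂ)} {p : Plaq (F.P K) j}
    (hp : 2 * (F.L : ℝ) ^ 2 * B₃ * θBal F.L γ b₀ p₀ (K - j + 1) ≤ GaugeGroup.dist1 (GaugeField.plaqHol Wf p)) :
    D.up K j Wf =
      (letI := W.regFintype K j
       ∑ r ∈ (Finset.univ : Finset (W.Reg K j)).erase (W.trivReg K j),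
          ∫ v, W.wt K j r v Wf *
              Real.exp (-(D.mainT K j (W.assemble K j r v) Wf) + D.Pint K j (W.assemble K j r v) Wf + D.Zterm K j (W.assemble K j r v))
            ∂Measure.pi (fun i : Fin j => fieldMeasure (F.P K) (i : ℕ) (Matrix.specialUnitaryGroup (Fin 2) ℂ))) :=
  lf_eq_sum_erase_of_large h hN hj hp _

/-- Conversely, where the datum is small enough for the trivial weight to integrate to at least `1`, the (41)-majorant dominates the trivial
history's exponential: `exp(−mainT(triv, W) + Pint(triv, W) + Zterm(triv)) ≤ up_j(W)`. [cite: Balaban1985UV3, (41) p.266 and (47) p.267] -/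
theorem exp_triv_le_up (h : LFSum D W) (K j : ℕ) (Wf : GaugeField (F.P K) j (Matrix.specialUnitaryGroup (Fin 2) ℂ))
    (hw : 1 ≤ ∫ v, W.wt K j (W.trivReg K j) v Wf
        ∂Measure.pi (fun i : Fin j => fieldMeasure (F.P K) (i : ℕ) (Matrix.specialUnitaryGroup (Fin 2) ℂ))) :
    Real.exp (-(D.mainT K j (D.triv K j) Wf) + D.Pint K j (D.triv K j) Wf + D.Zterm K j (D.triv K j)) ≤ D.up K j Wf :=
  exp_le_lf_of_wt_triv h K j Wf (fun h' => -(D.mainT K j h' Wf) + D.Pint K j h' Wf + D.Zterm K j h') hw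

/-! ## §3 The trivial term read as `low` (the 18916 consumer's R0 clause, stated inline: the trivial region history's weight IS `χ_j(W)`) -/

/-- If the trivial region history's weight is a constant `c` in the fibre variable (print: the all-`T_η` sequence carries no large-field integration,
its characteristic functions are functions of `V` alone — (40) p.266 with `Ω_j = T_η`), the trivial term of (41) is `c·exp Φ(triv)` (the fibre measure
is a product of normalised Haar measures). [cite: Balaban1985UV3, (40)-(41) p.266] -/
theorem trivTerm_eq_of_wt_eq (h : LFSum D W) (K j : ℕ) (Wf : GaugeField (F.P K) j (Matrix.specialUnitaryGroup (Fin 2) ℂ)) (Φ : D.Hist K j → ℝ)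
    {c : ℝ} (hc : ∀ v, W.wt K j (W.trivReg K j) v Wf = c) :
    ∫ v, W.wt K j (W.trivReg K j) v Wf * Real.exp (Φ (W.assemble K j (W.trivReg K j) v))
        ∂Measure.pi (fun i : Fin j => fieldMeasure (F.P K) (i : ℕ) (Matrix.specialUnitaryGroup (Fin 2) ℂ)) =
      c * Real.exp (Φ (D.triv K j)) := by
  rw [trivTerm_eq h K j Wf Φ]
  congr 1
  simp only [hc, integral_const, smul_eq_mul, probReal_univ, one_mul]

/-- **THE TRIVIAL TERM OF THE (41)-MAJORANT IS `low·e^{Zterm(triv)}`**: if the trivial weight is `χ_j(W)` (R0 clause of the 18916 consumer), the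
trivial region history's term of `up_j(W) = LF_j(W)[exp(−mainT + Pint + Zterm)]` equals `χ_j(W)·exp(−mainT(triv, W) + Pint(triv, W))·exp(Zterm(triv))
= low_j(W)·exp(Zterm(triv))` — (47) p.267's right side is exactly this term (there `Zterm(triv) = 0`: no `Z_j` at the trivial history).
[cite: Balaban1985UV3, (41) p.266 and (47) p.267] -/
theorem upTrivTerm_eq_low_mul (h : LFSum D W) {K j : ℕ} {Wf : GaugeField (F.P K) j (Matrix.specialUnitaryGroup (Fin 2) ℂ)}
    (hχ : ∀ v, W.wt K j (W.trivReg K j) v Wf = D.χ K j Wf) :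
    ∫ v, W.wt K j (W.trivReg K j) v Wf *
          Real.exp (-(D.mainT K j (W.assemble K j (W.trivReg K j) v) Wf) + D.Pint K j (W.assemble K j (W.trivReg K j) v) Wf +
            D.Zterm K j (W.assemble K j (W.trivReg K j) v))
        ∂Measure.pi (fun i : Fin j => fieldMeasure (F.P K) (i : ℕ) (Matrix.specialUnitaryGroup (Fin 2) ℂ)) =
      D.low K j Wf * Real.exp (D.Zterm K j (D.triv K j)) := by
  rw [trivTerm_eq_of_wt_eq h K j Wf (fun h' => -(D.mainT K j h' Wf) + D.Pint K j h' Wf + D.Zterm K j h') hχ]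
  simp only [AlphaDataT3.low, Real.exp_add]
  ring

open scoped Classical in
/-- **`up = low·e^{Zterm(triv)} +` THE NON-TRIVIAL HISTORIES** (under `LFSum` and the R0 clause): the (41)-majorant split at the trivial history with
its trivial term read as the (47)-minorant. [cite: Balaban1985UV3, (41) p.266 and (47) p.267] -/
theorem up_eq_low_mul_add_sum_erase (h : LFSum D W) {K j : ℕ} {Wf : GaugeField (F.P K) j (Matrix.specialUnitaryGroup (Fin 2) ℂ)}
    (hχ : ∀ v, W.wt K j (W.trivReg K j) v Wf = D.χ K j Wf) :
    D.up K j Wf =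
      D.low K j Wf * Real.exp (D.Zterm K j (D.triv K j)) +
      (letI := W.regFintype K j
       ∑ r ∈ (Finset.univ : Finset (W.Reg K j)).erase (W.trivReg K j),
          ∫ v, W.wt K j r v Wf *
              Real.exp (-(D.mainT K j (W.assemble K j r v) Wf) + D.Pint K j (W.assemble K j r v) Wf + D.Zterm K j (W.assemble K j r v))
            ∂Measure.pi (fun i : Fin j => fieldMeasure (F.P K) (i : ℕ) (Matrix.specialUnitaryGroup (Fin 2) ℂ))) := by
  letI := W.regFintype K j
  have hsplit := h.2.2 K j Wf (fun h' => -(D.mainT K j h' Wf) + D.Pint K j h' Wf + D.Zterm K j h')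
  rw [← Finset.add_sum_erase _ _ (Finset.mem_univ (W.trivReg K j)), upTrivTerm_eq_low_mul h hχ] at hsplit
  exact hsplit

/-- Under `LFSum` and the R0 clause, `low·e^{Zterm(triv)} ≤ up` pointwise (the other histories contribute non-negative terms).
[cite: Balaban1985UV3, (41) p.266 and (47) p.267] -/
theorem low_mul_exp_le_up (h : LFSum D W) {K j : ℕ} {Wf : GaugeField (F.P K) j (Matrix.specialUnitaryGroup (Fin 2) ℂ)}
    (hχ : ∀ v, W.wt K j (W.trivReg K j) v Wf = D.χ K j Wf) :
    D.low K j Wf * Real.exp (D.Zterm K j (D.triv K j)) ≤ D.up K j Wf := by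
  classical
  letI := W.regFintype K j
  rw [up_eq_low_mul_add_sum_erase h hχ]
  refine le_add_of_nonneg_right (Finset.sum_nonneg fun r _ => integral_nonneg fun v => ?_)
  exact mul_nonneg (h.1 K j r v Wf) (Real.exp_nonneg _)

/-- With `Zterm(triv) = 0` (no `Z_j` at the trivial history) the trivial term of `up` IS `low`, and `low ≤ up` pointwise.
[cite: Balaban1985UV3, (41) p.266 and (47) p.267] -/
theorem low_le_up (h : LFSum D W) {K j : ℕ} {Wf : GaugeField (F.P K) j (Matrix.specialUnitaryGroup (Fin 2) ℂ)}
    (hχ : ∀ v, W.wt K j (W.trivReg K j) v Wf = D.χ K j Wf) (hZ : D.Zterm K j (D.triv K j) = 0) : D.low K j Wf ≤ D.up K j Wf := by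
  simpa [hZ] using low_mul_exp_le_up h hχ

/-- The trivial up-term equals `low` when `Zterm(triv) = 0`. [cite: Balaban1985UV3, (41) p.266 and (47) p.267] -/
theorem upTrivTerm_eq_low (h : LFSum D W) {K j : ℕ} {Wf : GaugeField (F.P K) j (Matrix.specialUnitaryGroup (Fin 2) ℂ)}
    (hχ : ∀ v, W.wt K j (W.trivReg K j) v Wf = D.χ K j Wf) (hZ : D.Zterm K j (D.triv K j) = 0) :
    ∫ v, W.wt K j (W.trivReg K j) v Wf *
          Real.exp (-(D.mainT K j (W.assemble K j (W.trivReg K j) v) Wf) + D.Pint K j (W.assemble K j (W.trivReg K j) v) Wf +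
            D.Zterm K j (W.assemble K j (W.trivReg K j) v))
        ∂Measure.pi (fun i : Fin j => fieldMeasure (F.P K) (i : ℕ) (Matrix.specialUnitaryGroup (Fin 2) ℂ)) = D.low K j Wf := by
  rw [upTrivTerm_eq_low_mul h hχ, hZ, Real.exp_zero, mul_one]

end Literature.MathematicalPhysics.QuantumFieldTheory.Balaban1983to89.T3AlphaInputsACHistorySplit

end
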